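import Summits.PneNP.PneNP.Theses.RootDecompExchangeRate
import Literature.Computability.Complexity.CircuitClassesUniformProofs

/-!
# `RootDecompExchangeRate.QuadTimePPolyExplicit` (stmt-PneNP-31451) — the costume end of the exchange-rate square

Node N36 of the decomp-pnenp root-decomposition cell (route `route-PneNP-RootDecompExchangeRate`) records,
as an aside, the DECIDED corner of its time-vs-size square: `DTIME(n²) ⊆ ⋃_c SIZE(c·n⁴ + c)` — the
explicit-exponent form of `P ⊆ P/poly`: the tree's machine-to-circuit simulation
`FinTM2.exists_cktSize_sim` (`CircuitClassesUniformProofs`) turns a `k`-stack machine running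
`T(n) = c·nᵇ + c` steps with capacity `S = n + D·T + 1` into a `B₂`-circuit of size `≤ c₀(S+1)(T+1) =
O(n^{2b})` (arithmetic `sim_size_le'`).  Verbatim port of the lens-2 g10 kernel `sim_size_le` /
`DTIME_pow_subset_SIZEpoly` (ExchangeRate.lean 535f3e44, general `b ≥ 1`, with `SIZEpoly` inlined),
specialised at `b = 2`; certified closable by the cell critic's anchor probe Anchor_N36_ExchangeRate.lean
a7d92d56 (`tree_quadTimePPolyExplicit_holds`, 2026-08-30T09:00:01Z).  0 sorry.
-/

namespace Summit.PneNP.PneNP.Theorems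

open Literature.Computability.Complexity

/-- Arithmetic of the simulation size: with `T = c·nᵇ + c` steps and capacity `S = n + D·T + 1`,
`(S+1)(T+1) ≤ K·n²ᵇ + K` with `K = (2Dc+3)(2c+1)` for `b ≥ 1`.  Port of lens-2 g10 `sim_size_le`
(decomp-pnenp cell, 2026-08-30). [folklore] -/
private theorem sim_size_le' (D c b n : ℕ) (hb : 1 ≤ b) :
    (n + D * (c * n ^ b + c) + 1 + 1) * (c * n ^ b + c + 1) ≤
      (2 * (D * c) + 3) * (2 * c + 1) * n ^ (2 * b) + (2 * (D * c) + 3) * (2 * c + 1) := by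
  rcases Nat.eq_zero_or_pos n with rfl | hn
  · have hb0 : b ≠ 0 := by omega
    have h2b0 : 2 * b ≠ 0 := by omega
    simp only [zero_pow hb0, zero_pow h2b0, mul_zero, zero_add]
    have e1 : (D * c + 1 + 1) * (c + 1) = (D * c) * c + D * c + 2 * c + 2 := by ring
    have e2 : (2 * (D * c) + 3) * (2 * c + 1) = 4 * ((D * c) * c) + 2 * (D * c) + 6 * c + 3 := by ring
    rw [e1, e2]
    omega
  · set N := n ^ b with hN
    have hnN : n ≤ N := by
      have := Nat.pow_le_pow_right hn hb
      simpa using this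
    have hN1 : 1 ≤ N := Nat.one_le_pow _ _ hn
    have h2b : n ^ (2 * b) = N * N := by rw [two_mul, pow_add]
    rw [h2b]
    have hDc : D * c ≤ (D * c) * N := by
      simpa using Nat.mul_le_mul_left (D * c) hN1
    have hcN : c ≤ c * N := by
      simpa using Nat.mul_le_mul_left c hN1
    have hA : n + D * (c * N + c) + 1 + 1 ≤ (2 * (D * c) + 3) * N := by
      have e1 : n + D * (c * N + c) + 1 + 1 = n + (D * c) * N + D * c + 2 := by ring
      have e2 : (2 * (D * c) + 3) * N = (D * c) * N + (D * c) * N + 3 * N := by ring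
      rw [e1, e2]
      omega
    have hB : c * N + c + 1 ≤ (2 * c + 1) * N := by
      have e2 : (2 * c + 1) * N = c * N + c * N + N := by ring
      rw [e2]
      omega
    calc (n + D * (c * N + c) + 1 + 1) * (c * N + c + 1)
        ≤ (2 * (D * c) + 3) * N * ((2 * c + 1) * N) := Nat.mul_le_mul hA hB
      _ = (2 * (D * c) + 3) * (2 * c + 1) * (N * N) := by ring
      _ ≤ _ := Nat.le_add_right _ _

open Turing in
/-- `DTIME(nᵇ) ⊆ ⋃_c SIZE(c·n²ᵇ + c)` for `b ≥ 1` — the explicit-exponent form of `P ⊆ P/poly`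
(Arora–Barak 2009 Thm. 6.6, tableau form): the tree's `FinTM2.exists_cktSize_sim` gives a `B₂`-circuit
of size `≤ c₀(S+1)(T+1)` with `S = n + D·T + 1`, i.e. `O(n²ᵇ)` by `sim_size_le'`.  Port of lens-2 g10
`DTIME_pow_subset_SIZEpoly` (decomp-pnenp cell, 2026-08-30). [folklore] -/
private theorem DTIME_pow_subset_SIZE_two_mul {b : ℕ} (hb : 1 ≤ b) :
    DTIME (fun n => n ^ b) ⊆ ⋃ c : ℕ, SIZE (fun n => c * n ^ (2 * b) + c) := by
  intro L hL
  simp only [DTIME, TimeClass, Set.mem_setOf_eq] at hL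
  obtain ⟨c, M, hM⟩ := hL
  -- the simulation constants of the machine
  obtain ⟨c₀, D, hsim⟩ := FinTM2.exists_cktSize_sim M.tm (fun bit => M.inputAlphabet.symm bit)
    (M.outputAlphabet.symm true)
  -- running time and capacity at input length `n`
  set T : ℕ → ℕ := fun n => c * n ^ b + c with hT
  set S : ℕ → ℕ := fun n => n + D * T n + 1 with hS
  choose F hF hspec using fun n => hsim n (T n) (S n) (by simp [hS])
  choose C hC using fun n => (hF n).toCircuit
  refine Set.mem_iUnion.2 ⟨c₀ * ((2 * (D * c) + 3) * (2 * c + 1)), C,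
    fun n => ⟨(hC n).1, (hC n).2.1.trans ?_⟩, fun x => ?_⟩
  · -- size: `c₀ (S n + 1) (T n + 1) ≤ K n^{2b} + K`
    have key := sim_size_le' D c b n hb
    have eS : S n + 1 = n + D * (c * n ^ b + c) + 1 + 1 := by simp [hS, hT]
    have eT : T n + 1 = c * n ^ b + c + 1 := by simp [hT]
    calc c₀ * (S n + 1) * (T n + 1) = c₀ * ((S n + 1) * (T n + 1)) := by ring
      _ ≤ c₀ * ((2 * (D * c) + 3) * (2 * c + 1) * n ^ (2 * b) + (2 * (D * c) + 3) * (2 * c + 1)) := by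
          rw [eS, eT]; exact Nat.mul_le_mul_left _ key
      _ = c₀ * ((2 * (D * c) + 3) * (2 * c + 1)) * n ^ (2 * b)
            + c₀ * ((2 * (D * c) + 3) * (2 * c + 1)) := by ring
  · rw [(hC x.length).2.2]
    -- the machine's run on `x`
    have hx : Nonempty (TM2OutputsInTime M.tm (List.ofFn fun i => M.inputAlphabet.symm (x.get i))
        (some [M.outputAlphabet.symm (L.boolIndicator x)]) (T x.length)) := by
      have e : x.map M.inputAlphabet.symm = List.ofFn fun i => M.inputAlphabet.symm (x.get i) := by
        conv_lhs => rw [← List.ofFn_get x]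
        rw [List.map_ofFn]
        rfl
      have hp : ∀ b : Bool, (pure b : List Bool) = [b] := fun _ => rfl
      have := hM x
      simp only [TM2ComputableAux.OutputsWithin, Computability.encodeBool, id, hp, List.map_cons,
        List.map_nil, e] at this
      exact this
    have key := hspec x.length x.get _ [] hx
    rw [Equiv.apply_eq_iff_eq] at key
    rw [Bool.eq_iff_iff, key]

/-- `QuadTimePPolyExplicit` (stmt-PneNP-31451): `DTIME (n ↦ n²) ⊆ ⋃ c, SIZE (n ↦ c·n⁴ + c)` — the
explicit-exponent `P ⊆ P/poly` at `b = 2` (decomp-pnenp cell N36, the costume end `s ≥ 2b` of the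
exchange-rate square located by theorem; port of lens-2 g10 `compress_two_four` / critic
`tree_quadTimePPolyExplicit_holds`, 2026-08-30). -/
theorem quadTimePPolyExplicit_proof :
    Summit.PneNP.PneNP.Theses.RootDecompExchangeRate.QuadTimePPolyExplicit := by
  unfold Summit.PneNP.PneNP.Theses.RootDecompExchangeRate.QuadTimePPolyExplicit
  exact DTIME_pow_subset_SIZE_two_mul (b := 2) (by norm_num)

end Summit.PneNP.PneNP.Theorems
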